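import Mathlib.Geometry.Manifold.Instances.Real
import Literature.Topology.FourManifolds.PlanarSmoothStructures
import Literature.Topology.PlaneTopology.Rectangles
import HarnessLib

/-!
# Smooth structures on plane domains: straightening along a seam circle (inessential case)

Topic `Literature/Topology/FourManifolds` (smoothing theory of surfaces; brick of the `n = 2`
leaf — Radó 1925 / Kerékjártó: every topological surface admits a smooth structure — of the
named fact `Literature.Topology.FourManifolds.exists_chartedSpace_isManifold_of_le_three`,
spc4.S33). The inductive step of the chart-by-chart construction of a smooth structure (E. E.
Moise, *Geometric topology in dimensions 2 and 3*, GTM 47, Ch. 8; A. Hatcher, *The Kirby torus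
trick for surfaces*, arXiv:1312.3518, proof of Thm. A from the handle smoothing theorems) reads,
in a chart: a smooth atlas `𝒮` is given on an open `W ⊆ ℂ` (the part already smoothed) and one
wants a smooth atlas on an open set containing the disc `{‖z‖ < 2}` and the already smoothed
closed part `L ⊆ W`, unchanged off `{‖z‖ ≤ 3}`. This file proves it in the case where the seam
circle `{‖z‖ = 2}` is **not** contained in `W` (`exists_planeAtlas_seam_of_not_subset`):

* `exists_homeomorph_pullback_agreeOn_stdAtlas_finset` — finitely many `0`-handle moves with
  pairwise disjoint supports (from `exists_homeomorph_pullback_agreeOn_stdAtlas_jordan`);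
* `exists_polarRects_cover` — the compact set `L ∩ {‖z‖ = 2}` is covered by finitely many polar
  rectangles `P₁ i` with `closure (P₁ i) ⊆ P₂ i`, the `closure (P₂ i)` pairwise disjoint inside
  `W ∩ {1 < ‖z‖ < 3}` (components of an angular neighbourhood of the angle set);
* `exists_planeAtlas_seam_of_not_subset` — straighten `𝒮` over the `P₁ i`, then glue
  (`AtlasOn.union`) the standard structure on `{‖z‖ < 2} ∪ ⋃ P₁ i` with the straightened `𝒮`
  on `{‖z‖ > 2} ∪ ⋃ P₁ i`.

Auxiliary: vacuous agreement (`agreeOn_of_source_inter_eq_empty`), smoothness over unions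
(`isSmoothChart_restr_iUnion`, `agreeOn_stdAtlas_iUnion`), open connected subsets of `ℝ` are
intervals (`eq_Ioo_of_isOpen_isConnected`) and endpoints of components
(`sInf/sSup_connectedComponentIn_notMem`), polar coordinates (`exists_eq_polar_of_norm_eq`,
`polar_eq_polar_iff`). The complementary (essential) case, where the closed annulus
`{1 ≤ ‖z‖ ≤ 3}` lies in `W`, needs an `𝒮`-smooth essential annulus and is not treated here.

Everything is proved; no named facts.

## References

* A. Hatcher, *The Kirby torus trick for surfaces*, arXiv:1312.3518 (2013), proof of Thm. A.
* E. E. Moise, *Geometric topology in dimensions 2 and 3*, GTM 47 (1977), Ch. 8.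
-/


noncomputable section

namespace Literature.Topology.FourManifolds

open _root_.Set _root_.Metric _root_.OpenPartialHomeomorph _root_.Filter
open scoped _root_.Manifold _root_.Topology _root_.ContDiff
open Literature.Geometry.Manifold (AtlasOn)
open Literature.Geometry.Manifold.AtlasOn
open Literature.Probability.RandomPlanarGeometry (JordanDomain)
open Literature.Probability.RandomPlanarGeometry.JordanDomain
open Literature.Topology.PlaneTopology

/-- Local notation for the model plane `ℝ²`. -/
local notation "𝔼₂" => EuclideanSpace ℝ (Fin 2)

/-! ### Agreement over a set only involves the parts of the charts over it -/

/-- Restricting a chart to `O` or to `O ∩ S` is the same when the part of its source over `O`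
lies in `S`. [folklore] -/
theorem restr_inter_eq_restr_of_subset {X Y : Type*} [TopologicalSpace X] [TopologicalSpace Y]
    (e : OpenPartialHomeomorph X Y) {O S : Set X} (h : e.source ∩ O ⊆ S) : e.restr (O ∩ S) = e.restr O := by
  rw [← restr_source_inter e (O ∩ S), ← restr_source_inter e O]
  congr 1
  ext x
  exact ⟨fun hx => ⟨hx.1, hx.2.1⟩, fun hx => ⟨hx.1, hx.2, h hx⟩⟩

/-- **Agreement over `O` follows from agreement over `O ∩ S`** when the parts over `O` of the
sources of all charts of both atlases lie in `S`. [folklore] -/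
theorem agreeOn_of_agreeOn_inter {X : Type*} [TopologicalSpace X] {H : Type*} [TopologicalSpace H]
    {G : StructureGroupoid H} {U V O S : Set X} {𝒜 : AtlasOn G U} {ℬ : AtlasOn G V}
    (h : 𝒜.AgreeOn ℬ (O ∩ S)) (h𝒜 : ∀ e ∈ 𝒜.charts, e.source ∩ O ⊆ S) (hℬ : ∀ e ∈ ℬ.charts, e.source ∩ O ⊆ S) :
    𝒜.AgreeOn ℬ O := by
  intro e he e' he'
  have h1 := h e he e' he'
  rwa [restr_inter_eq_restr_of_subset e' (hℬ e' he'), restr_inter_eq_restr_of_subset e (h𝒜 e he)] at h1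

/-- Agreement over `O` implies agreement over `O ∩ S` (for open `O`, `S`). [folklore] -/
theorem agreeOn_inter {X : Type*} [TopologicalSpace X] {H : Type*} [TopologicalSpace H]
    {G : StructureGroupoid H} [ClosedUnderRestriction G] {U V O S : Set X} {𝒜 : AtlasOn G U} {ℬ : AtlasOn G V}
    (h : 𝒜.AgreeOn ℬ O) (hO : IsOpen O) (hS : IsOpen S) : 𝒜.AgreeOn ℬ (O ∩ S) :=
  h.mono hO (hO.inter hS) inter_subset_left

/-! ### Finitely many disjoint straightening moves -/

/-- The pulled-back atlas along a homeomorphism of `ℂ`, as an atlas on the preimage. [folklore] -/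
theorem pullback_homeomorph_carrier {W : Set ℂ} (Φ : ℂ ≃ₜ ℂ) :
    Φ.toOpenPartialHomeomorph.source ∩ Φ.toOpenPartialHomeomorph ⁻¹' W = Φ ⁻¹' W := by
  rw [Homeomorph.toOpenPartialHomeomorph_source, univ_inter]; rfl

/-- Sources of charts of a pull-back along a homeomorphism lie in the preimage of the carrier.
[folklore] -/
theorem source_subset_of_mem_pullback {W : Set ℂ} (𝒮 : PlaneAtlas W) (Φ : ℂ ≃ₜ ℂ)
    {e : OpenPartialHomeomorph ℂ 𝔼₂} (he : e ∈ (𝒮.pullback Φ.toOpenPartialHomeomorph).charts) :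
    e.source ⊆ Φ ⁻¹' W := by
  rw [← pullback_homeomorph_carrier Φ]
  exact (𝒮.pullback Φ.toOpenPartialHomeomorph).source_subset e he

/-- **Finitely many disjoint `0`-handle moves.** Given finitely many nested pairs of Jordan
domains `closure (P₁ i) ⊆ P₂ i` with pairwise disjoint `closure (P₂ i) ⊆ W`, there is a
homeomorphism `Φ` of `ℂ`, the identity off `⋃ closure (P₂ i)` and preserving each
`closure (P₂ i)`, such that `Φ*𝒮` is standard over every `P₁ i` and agrees with `𝒮` off
`⋃ closure (P₂ i)` (apply `exists_homeomorph_pullback_agreeOn_stdAtlas_jordan` one pair at a time;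
later moves are the identity near the earlier pairs). [folklore] -/
theorem exists_homeomorph_pullback_agreeOn_stdAtlas_finset {W : Set ℂ} (𝒮 : PlaneAtlas W)
    {ι : Type*} (s : Finset ι) (P₁ P₂ : ι → JordanDomain)
    (h12 : ∀ i ∈ s, closure (P₁ i).carrier ⊆ (P₂ i).carrier) (h2W : ∀ i ∈ s, closure (P₂ i).carrier ⊆ W)
    (hdisj : ∀ i ∈ s, ∀ j ∈ s, i ≠ j → Disjoint (closure (P₂ i).carrier) (closure (P₂ j).carrier)) :
    ∃ Φ : ℂ ≃ₜ ℂ, (∀ z, (∀ i ∈ s, z ∉ closure (P₂ i).carrier) → Φ z = z) ∧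
      (∀ i ∈ s, Φ '' closure (P₂ i).carrier = closure (P₂ i).carrier) ∧ Φ ⁻¹' W = W ∧
      (∀ i ∈ s, (𝒮.pullback Φ.toOpenPartialHomeomorph).AgreeOn (stdAtlas (P₁ i).carrier (P₁ i).isOpen) (P₁ i).carrier) ∧
      (𝒮.pullback Φ.toOpenPartialHomeomorph).AgreeOn 𝒮 (⋃ i ∈ s, closure (P₂ i).carrier)ᶜ := by
  classical
  induction s using Finset.induction_on with
  | empty =>
    refine ⟨Homeomorph.refl ℂ, fun z _ => rfl, by simp, rfl, by simp, ?_⟩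
    rw [agreeOn_iff_of_charts_eq (pullback_refl_charts 𝒮) rfl]
    exact AgreeOn.rfl (by simp)
  | insert a s ha ih =>
    obtain ⟨Φ', hΦ'id, hΦ'cl, hΦ'W, hΦ'std, hΦ'far⟩ := ih (fun i hi => h12 i (Finset.mem_insert_of_mem hi))
      (fun i hi => h2W i (Finset.mem_insert_of_mem hi))
      (fun i hi j hj hij => hdisj i (Finset.mem_insert_of_mem hi) j (Finset.mem_insert_of_mem hj) hij)
    -- the structure after the moves of `s`
    set 𝒮' := (𝒮.pullback Φ'.toOpenPartialHomeomorph).copy ((pullback_homeomorph_carrier Φ').trans hΦ'W) with h𝒮'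
    have h𝒮'charts : 𝒮'.charts = (𝒮.pullback Φ'.toOpenPartialHomeomorph).charts := rfl
    -- `Φ'` is the identity on `closure (P₂ a)`
    have hdisj_a : ∀ i ∈ s, Disjoint (closure (P₂ a).carrier) (closure (P₂ i).carrier) := fun i hi =>
      hdisj a (Finset.mem_insert_self a s) i (Finset.mem_insert_of_mem hi) (fun h => ha (h ▸ hi))
    have hΦ'a : ∀ z ∈ closure (P₂ a).carrier, Φ' z = z := fun z hz =>
      hΦ'id z fun i hi => Set.disjoint_left.1 (hdisj_a i hi) hz
    have haW : closure (P₂ a).carrier ⊆ W := h2W a (Finset.mem_insert_self a s)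
    obtain ⟨Φa, hΦaid, hΦacl, hΦastd, hΦafar⟩ :=
      exists_homeomorph_pullback_agreeOn_stdAtlas_jordan 𝒮' (P₁ a) (P₂ a) (h12 a (Finset.mem_insert_self a s)) haW
    -- `Φa` is the identity on the other closures
    have hΦa_other : ∀ i ∈ s, ∀ z ∈ closure (P₂ i).carrier, Φa z = z := fun i hi z hz =>
      hΦaid z fun h => Set.disjoint_left.1 (hdisj_a i hi) h hz
    set Φ : ℂ ≃ₜ ℂ := Φa.trans Φ' with hΦ
    have hΦ_apply : ∀ z, Φ z = Φ' (Φa z) := fun z => rfl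
    have hcharts : (𝒮.pullback Φ.toOpenPartialHomeomorph).charts = (𝒮'.pullback Φa.toOpenPartialHomeomorph).charts := by
      rw [hΦ, Homeomorph.trans_toOpenPartialHomeomorph, ← pullback_pullback_charts]
      rfl
    have hΦaW : Φa ⁻¹' W = W := by
      ext z
      by_cases hz : z ∈ closure (P₂ a).carrier
      · have h1 : Φa z ∈ closure (P₂ a).carrier := by rw [← hΦacl]; exact mem_image_of_mem _ hz
        exact ⟨fun _ => haW hz, fun _ => haW h1⟩
      · show Φa z ∈ W ↔ z ∈ W
        rw [hΦaid z hz]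
    refine ⟨Φ, fun z hz => ?_, fun i hi => ?_, ?_, fun i hi => ?_, ?_⟩
    · rw [hΦ_apply, hΦaid z (hz a (Finset.mem_insert_self a s)),
        hΦ'id z fun i hi => hz i (Finset.mem_insert_of_mem hi)]
    · have : (Φ : ℂ → ℂ) = Φ' ∘ Φa := rfl
      rw [this, image_comp]
      rcases Finset.mem_insert.1 hi with rfl | hi
      · rw [hΦacl]; exact (image_congr fun z hz => hΦ'a z hz).trans (image_id' _)
      · rw [(image_congr fun z hz => hΦa_other i hi z hz).trans (image_id' _), hΦ'cl i hi]
    · show Φ ⁻¹' W = W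
      have : (Φ : ℂ → ℂ) = Φ' ∘ Φa := rfl
      rw [this, preimage_comp, hΦ'W, hΦaW]
    · rw [agreeOn_iff_of_charts_eq hcharts rfl]
      rcases Finset.mem_insert.1 hi with rfl | hi
      · exact hΦastd
      · -- over `P₁ i` the move `Φa` is the identity, so `Φa*𝒮'` agrees with `𝒮'`, which is standard there
        have hPi : (P₁ i).carrier ⊆ (closure (P₂ a).carrier)ᶜ := fun z hz h =>
          Set.disjoint_left.1 (hdisj_a i hi) h
            (h12 i (Finset.mem_insert_of_mem hi) (subset_closure hz) |> subset_closure)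
        have h1 : (𝒮'.pullback Φa.toOpenPartialHomeomorph).AgreeOn 𝒮' (P₁ i).carrier :=
          hΦafar.mono isClosed_closure.isOpen_compl (P₁ i).isOpen hPi
        have h2 : 𝒮'.AgreeOn (stdAtlas (P₁ i).carrier (P₁ i).isOpen) (P₁ i).carrier := by
          rw [agreeOn_iff_of_charts_eq h𝒮'charts rfl]; exact hΦ'std i hi
        have h3 := h1.trans h2 (P₁ i).isOpen
        have hPiW : (P₁ i).carrier ⊆ W := fun z hz =>
          h2W i (Finset.mem_insert_of_mem hi) (h12 i (Finset.mem_insert_of_mem hi) (subset_closure hz) |> subset_closure)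
        exact h3.mono ((P₁ i).isOpen.inter 𝒮'.isOpen) (P₁ i).isOpen fun z hz => ⟨hz, hPiW hz⟩
    · rw [agreeOn_iff_of_charts_eq hcharts rfl]
      set O : Set ℂ := (⋃ i ∈ insert a s, closure (P₂ i).carrier)ᶜ with hO
      have hOo : IsOpen O := by
        rw [hO, isOpen_compl_iff]
        exact (Finset.finite_toSet _).isClosed_biUnion fun i _ => isClosed_closure
      have hOa : O ⊆ (closure (P₂ a).carrier)ᶜ := by
        rw [hO]; intro z hz h; exact hz (mem_biUnion (Finset.mem_insert_self a s) h)
      have hOs : O ⊆ (⋃ i ∈ s, closure (P₂ i).carrier)ᶜ := by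
        rw [hO]; intro z hz h
        obtain ⟨i, hi, hzi⟩ := mem_iUnion₂.1 h
        exact hz (mem_biUnion (Finset.mem_insert_of_mem hi) hzi)
      have h1 : (𝒮'.pullback Φa.toOpenPartialHomeomorph).AgreeOn 𝒮' O :=
        hΦafar.mono isClosed_closure.isOpen_compl hOo hOa
      have h2 : 𝒮'.AgreeOn 𝒮 O := by
        rw [agreeOn_iff_of_charts_eq h𝒮'charts rfl]
        refine hΦ'far.mono ?_ hOo hOs
        rw [isOpen_compl_iff]
        exact (Finset.finite_toSet _).isClosed_biUnion fun i _ => isClosed_closure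
      have h3 := h1.trans h2 hOo
      -- `O ∩ W` suffices: all chart sources lie in `W` (the moves preserve `W`)
      refine agreeOn_of_agreeOn_inter h3 (fun e he => ?_) (fun e he => ?_)
      · have := source_subset_of_mem_pullback 𝒮' Φa he
        rw [hΦaW] at this
        exact inter_subset_left.trans this
      · exact inter_subset_left.trans (𝒮.source_subset e he)

end Literature.Topology.FourManifolds

end


noncomputable section

namespace Literature.Topology.FourManifolds

open _root_.Set _root_.Metric _root_.OpenPartialHomeomorph _root_.Filter _root_.Real
open scoped _root_.Manifold _root_.Topology _root_.ContDiff
open Literature.Geometry.Manifold (AtlasOn)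
open Literature.Geometry.Manifold.AtlasOn
open Literature.Probability.RandomPlanarGeometry (JordanDomain)
open Literature.Probability.RandomPlanarGeometry.JordanDomain
open Literature.Topology.PlaneTopology
open Literature.Topology.PlaneTopology.CircleTwist (turn norm_turn turn_eq_turn_iff exists_turn_eq turn_add_intCast)

/-- Local notation for the model plane `ℝ²`. -/
local notation "𝔼₂" => EuclideanSpace ℝ (Fin 2)

/-! ### Vacuous agreement -/

/-- **Agreement over `O` is vacuous when no chart of the first atlas meets `O`** (both
transition maps have empty source, so `ContDiffGroupoid.mem_of_source_eq_empty` applies).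
[folklore] -/
theorem agreeOn_of_source_inter_eq_empty {U V O : Set ℂ} {𝒜 : PlaneAtlas U} {ℬ : PlaneAtlas V}
    (h : ∀ e ∈ 𝒜.charts, e.source ∩ O = ∅) : 𝒜.AgreeOn ℬ O := by
  intro e he e' he'
  constructor
  · apply ContDiffGroupoid.mem_of_source_eq_empty
    rw [trans_source]
    ext y
    simp only [mem_inter_iff, mem_preimage, symm_source, mem_empty_iff_false, iff_false, not_and]
    intro hy hy'
    rw [restr_source] at hy'
    have : e.symm y ∈ e.source ∩ O := ⟨e.map_target hy, interior_subset hy'.2⟩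
    rw [h e he] at this
    exact this
  · apply ContDiffGroupoid.mem_of_source_eq_empty
    rw [trans_source]
    ext y
    simp only [mem_inter_iff, mem_preimage, symm_source, mem_empty_iff_false, iff_false, not_and]
    intro _ hy'
    rw [restr_source] at hy'
    have : e'.symm y ∈ e.source ∩ O := ⟨hy'.1, interior_subset hy'.2⟩
    rw [h e he] at this
    exact this

/-! ### Smooth charts over unions of open sets -/

/-- **Smoothness of a chart over a union of open sets is smoothness over each.** [folklore] -/
theorem isSmoothChart_restr_iUnion {ι : Type*} {e : OpenPartialHomeomorph ℂ 𝔼₂} {O : ι → Set ℂ}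
    (hO : ∀ i, IsOpen (O i)) (h : ∀ i, IsSmoothChart (e.restr (O i))) : IsSmoothChart (e.restr (⋃ i, O i)) := by
  have hU : IsOpen (⋃ i, O i) := isOpen_iUnion hO
  constructor
  · rw [restr_source' _ _ hU]
    intro x hx
    obtain ⟨i, hi⟩ := mem_iUnion.1 hx.2
    have h1 := (h i).1
    rw [restr_source' _ _ (hO i)] at h1
    have h3 : ContDiffAt ℝ ∞ (e.restr (O i)) x :=
      (h1 x ⟨hx.1, hi⟩).contDiffAt ((e.open_source.inter (hO i)).mem_nhds ⟨hx.1, hi⟩)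
    exact h3.contDiffWithinAt
  · rw [restr_target, interior_eq_iff_isOpen.2 hU]
    intro y hy
    obtain ⟨i, hi⟩ := mem_iUnion.1 hy.2
    have h1 := (h i).2
    rw [restr_target, interior_eq_iff_isOpen.2 (hO i)] at h1
    have h3 : ContDiffAt ℝ ∞ (e.restr (O i)).symm y :=
      (h1 y ⟨hy.1, hi⟩).contDiffAt ((e.isOpen_inter_preimage_symm (hO i)).mem_nhds ⟨hy.1, hi⟩)
    exact h3.contDiffWithinAt

/-- Agreement with the standard structure over each of a family of open sets gives agreement
over their union. [folklore] -/
theorem agreeOn_stdAtlas_iUnion {ι : Type*} {W : Set ℂ} (𝒮 : PlaneAtlas W) {O : ι → Set ℂ} (hO : ∀ i, IsOpen (O i))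
    (h : ∀ i, 𝒮.AgreeOn (stdAtlas (O i) (hO i)) (O i)) :
    𝒮.AgreeOn (stdAtlas (⋃ i, O i) (isOpen_iUnion hO)) (⋃ i, O i) :=
  agreeOn_stdAtlas_of_isSmoothChart 𝒮 _ fun _ he =>
    isSmoothChart_restr_iUnion hO fun i => isSmoothChart_restr_of_agreeOn_stdAtlas (hO i) (h i) he

/-- Two standard atlases agree over the smaller open set. [folklore] -/
theorem stdAtlas_agreeOn_stdAtlas {O O' : Set ℂ} (hO : IsOpen O) (hO' : IsOpen O') :
    (stdAtlas O hO).AgreeOn (stdAtlas O' hO') O' :=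
  agreeOn_stdAtlas_of_isSmoothChart _ hO' fun e he => by
    rw [stdAtlas_charts, mem_singleton_iff] at he
    subst he
    exact (isSmoothChart_stdChart.restr hO).restr hO'

/-! ### Open connected subsets of `ℝ` -/

/-- **A nonempty bounded open connected subset of `ℝ` is the open interval between its infimum
and supremum.** [folklore] -/
theorem eq_Ioo_of_isOpen_isConnected {c : Set ℝ} (hc : IsOpen c) (hconn : IsConnected c)
    (hb : BddBelow c) (ha : BddAbove c) : c = Ioo (sInf c) (sSup c) := by
  have hoc : OrdConnected c := (isPreconnected_iff_ordConnected.1 hconn.isPreconnected)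
  apply Subset.antisymm
  · intro x hx
    refine ⟨lt_of_le_of_ne (csInf_le hb hx) fun h => ?_, lt_of_le_of_ne (le_csSup ha hx) fun h => ?_⟩
    · -- `x = inf c ∈ c` open: points below `x` lie in `c`
      obtain ⟨ε, hε, hball⟩ := Metric.isOpen_iff.1 hc x hx
      have hmem : x - ε / 2 ∈ ball x ε := by
        rw [mem_ball, Real.dist_eq, abs_lt]; constructor <;> linarith
      have := csInf_le hb (hball hmem)
      linarith
    · obtain ⟨ε, hε, hball⟩ := Metric.isOpen_iff.1 hc x hx
      have hmem : x + ε / 2 ∈ ball x ε := by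
        rw [mem_ball, Real.dist_eq, abs_lt]; constructor <;> linarith
      have := le_csSup ha (hball hmem)
      linarith
  · intro y hy
    obtain ⟨a, hac, hay⟩ := exists_lt_of_csInf_lt hconn.nonempty hy.1
    obtain ⟨b, hbc, hyb⟩ := exists_lt_of_lt_csSup hconn.nonempty hy.2
    exact hoc.out hac hbc ⟨hay.le, hyb.le⟩

/-- The endpoints of a connected component of an open subset of `ℝ` do not belong to the set.
[folklore] -/
theorem sSup_connectedComponentIn_notMem {V : Set ℝ} (hV : IsOpen V) {t : ℝ} (ht : t ∈ V)
    (ha : BddAbove (connectedComponentIn V t)) : sSup (connectedComponentIn V t) ∉ V := by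
  intro hs
  set c := connectedComponentIn V t with hc
  have hco : IsOpen c := hV.connectedComponentIn
  have hne : c.Nonempty := ⟨t, mem_connectedComponentIn ht⟩
  -- a small interval around `sup c` lies in `V`, and is connected to `c`
  obtain ⟨ε, hε, hball⟩ := Metric.isOpen_iff.1 hV _ hs
  obtain ⟨b, hbc, hb⟩ := exists_lt_of_lt_csSup hne (show sSup c - ε < sSup c by linarith)
  have hI : Icc b (sSup c + ε / 2) ⊆ V := by
    intro x hx
    rcases le_or_gt x (sSup c - ε) with h | h
    · exact absurd (hx.1.trans h) (not_le.2 hb)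
    · by_cases hxc : x ∈ c
      · exact connectedComponentIn_subset _ _ hxc
      · apply hball
        rw [mem_ball, Real.dist_eq, abs_lt]
        constructor <;> linarith [hx.2]
  have hsub : Icc b (sSup c + ε / 2) ⊆ c := by
    have h1 : IsPreconnected (Icc b (sSup c + ε / 2)) := isPreconnected_Icc
    have h2 : b ∈ Icc b (sSup c + ε / 2) := ⟨le_rfl, by linarith [le_csSup ha hbc]⟩
    have := h1.subset_connectedComponentIn h2 hI
    rwa [← connectedComponentIn_eq hbc] at this
  have := le_csSup ha (hsub ⟨by linarith [le_csSup ha hbc], le_rfl⟩)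
  linarith

/-- The endpoints of a connected component of an open subset of `ℝ` do not belong to the set
(infimum). [folklore] -/
theorem sInf_connectedComponentIn_notMem {V : Set ℝ} (hV : IsOpen V) {t : ℝ} (ht : t ∈ V)
    (hb : BddBelow (connectedComponentIn V t)) : sInf (connectedComponentIn V t) ∉ V := by
  intro hs
  set c := connectedComponentIn V t with hc
  have hne : c.Nonempty := ⟨t, mem_connectedComponentIn ht⟩
  obtain ⟨ε, hε, hball⟩ := Metric.isOpen_iff.1 hV _ hs
  obtain ⟨b, hbc, hb'⟩ := exists_lt_of_csInf_lt hne (show sInf c < sInf c + ε by linarith)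
  have hI : Icc (sInf c - ε / 2) b ⊆ V := by
    intro x hx
    rcases le_or_gt (sInf c + ε) x with h | h
    · exact absurd (h.trans hx.2) (not_le.2 hb')
    · by_cases hxc : x ∈ c
      · exact connectedComponentIn_subset _ _ hxc
      · apply hball
        rw [mem_ball, Real.dist_eq, abs_lt]
        constructor <;> linarith [hx.1]
  have hsub : Icc (sInf c - ε / 2) b ⊆ c := by
    have h1 : IsPreconnected (Icc (sInf c - ε / 2) b) := isPreconnected_Icc
    have h2 : b ∈ Icc (sInf c - ε / 2) b := ⟨by linarith [csInf_le hb hbc], le_rfl⟩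
    have := h1.subset_connectedComponentIn h2 hI
    rwa [← connectedComponentIn_eq hbc] at this
  have := csInf_le hb (hsub ⟨le_rfl, by linarith [csInf_le hb hbc]⟩)
  linarith

/-! ### Polar points -/

/-- Every point of the circle of radius `ρ > 0` is `ρ · turn θ` with `θ` in any window
`[θ₀, θ₀ + 1)`. [folklore] -/
theorem exists_eq_polar_of_norm_eq {z : ℂ} {ρ : ℝ} (hρ : 0 < ρ) (hz : ‖z‖ = ρ) (θ₀ : ℝ) :
    ∃ θ ∈ Ico θ₀ (θ₀ + 1), z = (ρ : ℂ) * turn θ := by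
  have hw : ‖z / ρ‖ = 1 := by rw [norm_div, Complex.norm_real, Real.norm_eq_abs, abs_of_pos hρ, hz, div_self hρ.ne']
  obtain ⟨t, ht⟩ := exists_turn_eq hw
  refine ⟨t - ⌊t - θ₀⌋, ⟨?_, ?_⟩, ?_⟩
  · have := Int.floor_le (t - θ₀); linarith
  · have := Int.lt_floor_add_one (t - θ₀); linarith
  · have e1 : t - (⌊t - θ₀⌋ : ℝ) = t + ((-⌊t - θ₀⌋ : ℤ) : ℝ) := by push_cast; ring
    have hρ' : (ρ : ℂ) ≠ 0 := by exact_mod_cast hρ.ne'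
    rw [e1, turn_add_intCast, ht]
    field_simp

/-- `turn θ` is the exponential `exp (2πθ i)` of `Rectangles.lean`. [folklore] -/
theorem turn_def (θ : ℝ) : turn θ = Complex.exp (2 * π * θ * Complex.I) := rfl

/-- Uniqueness of polar coordinates with angles in a window of length `< 1`. [folklore] -/
theorem polar_eq_polar_iff {r r' θ θ' : ℝ} (hr : 0 < r) (hr' : 0 < r') (h : |θ - θ'| < 1) :
    (r : ℂ) * turn θ = (r' : ℂ) * turn θ' ↔ r = r' ∧ θ = θ' := by
  constructor
  · intro heq
    have hn : r = r' := by
      have := congrArg (‖·‖) heq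
      simpa [norm_mul, Complex.norm_real, Real.norm_eq_abs, abs_of_pos hr, abs_of_pos hr'] using this
    subst hn
    have ht : turn θ = turn θ' := mul_left_cancel₀ (by exact_mod_cast hr.ne') heq
    obtain ⟨n, hn⟩ := turn_eq_turn_iff.1 ht
    have : (n : ℝ) = θ - θ' := by linarith
    have habs : |(n : ℝ)| < 1 := by rw [this]; exact h
    have hn0 : n = 0 := by
      have h4 : |n| < 1 := by exact_mod_cast habs
      rw [abs_lt] at h4; omega
    subst hn0
    exact ⟨rfl, by simpa using hn⟩
  · rintro ⟨rfl, rfl⟩; rfl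

end Literature.Topology.FourManifolds

end


noncomputable section

namespace Literature.Topology.FourManifolds

open _root_.Set _root_.Metric _root_.OpenPartialHomeomorph _root_.Filter _root_.Real
open scoped _root_.Manifold _root_.Topology _root_.ContDiff
open Literature.Geometry.Manifold (AtlasOn)
open Literature.Geometry.Manifold.AtlasOn
open Literature.Probability.RandomPlanarGeometry (JordanDomain)
open Literature.Probability.RandomPlanarGeometry.JordanDomain
open Literature.Topology.PlaneTopology
open Literature.Topology.PlaneTopology.CircleTwist (turn norm_turn turn_eq_turn_iff exists_turn_eq turn_add_intCast continuous_turn)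

/-- Local notation for the model plane `ℝ²`. -/
local notation "𝔼₂" => EuclideanSpace ℝ (Fin 2)

/-! ### Covering a compact part of the seam circle by fat disjoint polar rectangles -/

/-- Distance of polar points in terms of `turn`. [folklore] -/
theorem norm_polar_turn_sub_le {r r' θ θ' : ℝ} (hr' : 0 ≤ r') :
    ‖(r : ℂ) * turn θ - (r' : ℂ) * turn θ'‖ ≤ |r - r'| + 2 * π * r' * |θ - θ'| :=
  norm_polar_sub_polar_le hr'

/-- **Fat disjoint polar rectangles about a compact proper part of a circle.** Let `C` be a
compact subset of the circle `‖z‖ = 2` contained in the open set `W`, and suppose the circle is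
not contained in `W`. Then finitely many polar rectangles `P₁ i` cover `C`, with
`closure (P₁ i) ⊆ P₂ i`, the `closure (P₂ i)` pairwise disjoint and contained in
`W ∩ {1 < ‖z‖ < 3}`. (The components of the angular `2δ'`-neighbourhood of the angle set of `C`
which meet it are finitely many open intervals; over each, two nested polar rectangles.)
[folklore] -/
theorem exists_polarRects_cover {W C : Set ℂ} (hW : IsOpen W) (hC : IsCompact C) (hCW : C ⊆ W)
    (hC2 : C ⊆ sphere (0 : ℂ) 2) (hA : ¬ sphere (0 : ℂ) 2 ⊆ W) :
    ∃ (ι : Type) (_ : Fintype ι) (P₁ P₂ : ι → JordanDomain), (∀ i, closure (P₁ i).carrier ⊆ (P₂ i).carrier) ∧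
      (∀ i, closure (P₂ i).carrier ⊆ W ∩ {z | 1 < ‖z‖ ∧ ‖z‖ < 3}) ∧
      (∀ i j, i ≠ j → Disjoint (closure (P₂ i).carrier) (closure (P₂ j).carrier)) ∧
      C ⊆ ⋃ i, (P₁ i).carrier := by
  classical
  -- the open annulus `A₀ = {1 < ‖z‖ < 3}` and a uniform thickening of `C` inside `W ∩ A₀`
  set A₀ : Set ℂ := {z | 1 < ‖z‖ ∧ ‖z‖ < 3} with hA₀
  have hA₀o : IsOpen A₀ := (isOpen_lt continuous_const continuous_norm).inter (isOpen_lt continuous_norm continuous_const)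
  have hCA : C ⊆ W ∩ A₀ := fun z hz => ⟨hCW hz, by
    have := mem_sphere_zero_iff_norm.1 (hC2 hz); rw [hA₀, mem_setOf_eq, this]; norm_num⟩
  obtain ⟨δ₀, hδ₀, hthick₀⟩ := hC.exists_cthickening_subset_open (hW.inter hA₀o) hCA
  set δ : ℝ := min δ₀ 1 with hδ
  have hδp : 0 < δ := lt_min hδ₀ one_pos
  have hδ1 : δ ≤ 1 := min_le_right _ _
  have hthick : cthickening δ C ⊆ W ∩ A₀ := (cthickening_mono (min_le_left _ _) C).trans hthick₀
  have hnear : ∀ c ∈ C, ∀ z, dist z c ≤ δ → z ∈ W ∩ A₀ := fun c hc z hz =>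
    hthick (mem_cthickening_of_dist_le z c δ C hc hz)
  -- a point of the circle outside `W`, as the origin of angles
  obtain ⟨p, hp, hpW⟩ := not_subset.1 hA
  obtain ⟨θs, -, hpθ⟩ := exists_eq_polar_of_norm_eq two_pos (mem_sphere_zero_iff_norm.1 hp) 0
  -- the compact angle set of `C` in the window `[θs, θs + 1]`
  set pol : ℝ → ℂ := fun θ => (2 : ℂ) * turn θ with hpol
  have hpolc : Continuous pol := continuous_const.mul continuous_turn
  set A : Set ℝ := Icc θs (θs + 1) ∩ pol ⁻¹' C with hAdef
  have hAc : IsCompact A := isCompact_Icc.inter_right (hC.isClosed.preimage hpolc)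
  have hpolA : ∀ a ∈ A, pol a ∈ C := fun a ha => ha.2
  -- angular separation from `θs`
  set δ' : ℝ := δ / 64 with hδ'
  have hδ'p : 0 < δ' := by positivity
  have hfar : ∀ a ∈ A, 4 * δ' < |a - θs| ∧ 4 * δ' < |a - (θs + 1)| := by
    intro a ha
    have hd : δ < dist p (pol a) := by
      by_contra hle
      push Not at hle
      exact hpW (hnear _ (hpolA a ha) p hle).1
    have hp1 : p = ((2 : ℝ) : ℂ) * turn (θs + 1) := by
      have := turn_add_intCast θs 1
      push_cast at this
      rw [this, hpθ]
    have key : ∀ t, p = ((2 : ℝ) : ℂ) * turn t → 4 * δ' < |a - t| := by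
      intro t ht
      have h1 : dist p (pol a) ≤ |(2 : ℝ) - 2| + 2 * π * 2 * |t - a| := by
        rw [dist_eq_norm, ht, hpol]
        have := norm_polar_turn_sub_le (r := 2) (r' := 2) (θ := t) (θ' := a) (by norm_num)
        push_cast at this ⊢
        exact this
      rw [sub_self, abs_zero, zero_add, abs_sub_comm] at h1
      have h2 : δ < 4 * π * |a - t| := by linarith
      rw [hδ']
      nlinarith [pi_le_four, abs_nonneg (a - t), pi_pos]
    exact ⟨key θs hpθ, key (θs + 1) hp1⟩
  have hAIoo : ∀ a ∈ A, θs + 4 * δ' < a ∧ a < θs + 1 - 4 * δ' := by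
    intro a ha
    obtain ⟨h1, h2⟩ := hfar a ha
    have ha1 := ha.1.1
    have ha2 := ha.1.2
    rw [abs_of_nonneg (by linarith)] at h1
    rw [abs_of_nonpos (by linarith)] at h2
    exact ⟨by linarith, by linarith⟩
  -- the angular neighbourhood `V₀` and its components through points of `A`
  set V₀ : Set ℝ := thickening (2 * δ') A with hV₀
  have hV₀o : IsOpen V₀ := isOpen_thickening
  have hAV₀ : A ⊆ V₀ := fun a ha => mem_thickening_iff.2 ⟨a, ha, by rw [dist_self]; positivity⟩
  have hV₀sub : V₀ ⊆ Ioo (θs + 2 * δ') (θs + 1 - 2 * δ') := by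
    intro θ hθ
    obtain ⟨a, ha, hd⟩ := mem_thickening_iff.1 hθ
    rw [Real.dist_eq, abs_lt] at hd
    obtain ⟨h1, h2⟩ := hAIoo a ha
    exact ⟨by linarith, by linarith⟩
  set comp : ℝ → Set ℝ := fun a => connectedComponentIn V₀ a with hcomp
  set 𝒞 : Set (Set ℝ) := comp '' A with h𝒞
  have h𝒞fin : 𝒞.Finite := by
    obtain ⟨t, ht⟩ := hAc.elim_finite_subcover (fun a : A => comp a.1) (fun a => hV₀o.connectedComponentIn)
      (fun a ha => mem_iUnion.2 ⟨⟨a, ha⟩, mem_connectedComponentIn (hAV₀ ha)⟩)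
    refine (t.finite_toSet.image fun a : A => comp a.1).subset ?_
    rintro _ ⟨a, ha, rfl⟩
    obtain ⟨b, hb, hab⟩ := mem_iUnion₂.1 (ht ha)
    exact ⟨b, hb, connectedComponentIn_eq hab⟩
  -- basic properties of the components
  have hcV₀ : ∀ c ∈ 𝒞, c ⊆ V₀ := by
    rintro _ ⟨a, -, rfl⟩; exact connectedComponentIn_subset _ _
  have hcopen : ∀ c ∈ 𝒞, IsOpen c := by
    rintro _ ⟨a, -, rfl⟩; exact hV₀o.connectedComponentIn
  have hcconn : ∀ c ∈ 𝒞, IsConnected c := by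
    rintro _ ⟨a, ha, rfl⟩; exact isConnected_connectedComponentIn_iff.2 (hAV₀ ha)
  have hcbdd : ∀ c ∈ 𝒞, BddBelow c ∧ BddAbove c := fun c hc =>
    ⟨⟨θs + 2 * δ', fun x hx => (hV₀sub (hcV₀ c hc hx)).1.le⟩, ⟨θs + 1 - 2 * δ', fun x hx => (hV₀sub (hcV₀ c hc hx)).2.le⟩⟩
  have hcIoo : ∀ c ∈ 𝒞, c = Ioo (sInf c) (sSup c) := fun c hc =>
    eq_Ioo_of_isOpen_isConnected (hcopen c hc) (hcconn c hc) (hcbdd c hc).1 (hcbdd c hc).2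
  have hcne : ∀ c ∈ 𝒞, c.Nonempty := fun c hc => (hcconn c hc).nonempty
  have hinf_ge : ∀ c ∈ 𝒞, θs + 2 * δ' ≤ sInf c := fun c hc =>
    le_csInf (hcne c hc) fun x hx => (hV₀sub (hcV₀ c hc hx)).1.le
  have hsup_le : ∀ c ∈ 𝒞, sSup c ≤ θs + 1 - 2 * δ' := fun c hc =>
    csSup_le (hcne c hc) fun x hx => (hV₀sub (hcV₀ c hc hx)).2.le
  -- endpoints are `2δ'`-far from `A`; points of `A ∩ c` are `2δ'` inside
  have hends : ∀ c ∈ 𝒞, sInf c ∉ V₀ ∧ sSup c ∉ V₀ := by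
    rintro _ ⟨a, ha, rfl⟩
    have hb := hcbdd _ ⟨a, ha, rfl⟩
    exact ⟨sInf_connectedComponentIn_notMem hV₀o (hAV₀ ha) hb.1, sSup_connectedComponentIn_notMem hV₀o (hAV₀ ha) hb.2⟩
  have hinside : ∀ c ∈ 𝒞, ∀ a ∈ A, a ∈ c → sInf c + 2 * δ' ≤ a ∧ a ≤ sSup c - 2 * δ' := by
    intro c hc a ha hac
    obtain ⟨h1, h2⟩ := hends c hc
    have hac' := hac
    rw [hcIoo c hc] at hac'
    have k1 : ¬ dist (sInf c) a < 2 * δ' := fun h => h1 (mem_thickening_iff.2 ⟨a, ha, h⟩)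
    have k2 : ¬ dist (sSup c) a < 2 * δ' := fun h => h2 (mem_thickening_iff.2 ⟨a, ha, h⟩)
    rw [Real.dist_eq, not_lt, abs_of_nonpos (by linarith [hac'.1])] at k1
    rw [Real.dist_eq, not_lt, abs_of_nonneg (by linarith [hac'.2])] at k2
    exact ⟨by linarith, by linarith⟩
  have hwidth : ∀ c ∈ 𝒞, sInf c + 4 * δ' ≤ sSup c := by
    rintro c ⟨a, ha, rfl⟩
    obtain ⟨h1, h2⟩ := hinside _ ⟨a, ha, rfl⟩ a ha (mem_connectedComponentIn (hAV₀ ha))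
    linarith
  -- the two polar rectangles over a component
  set ι := ↥𝒞
  haveI : Fintype ι := h𝒞fin.fintype
  have hr₁ : (0 : ℝ) < 2 - δ' := by rw [hδ']; linarith
  have hr₁' : (0 : ℝ) < 2 - 2 * δ' := by rw [hδ']; linarith
  set P₁ : ι → JordanDomain := fun c => polarRect (r₁ := 2 - δ') (r₂ := 2 + δ') (θ₁ := sInf c.1 + δ')
    (θ₂ := sSup c.1 - δ') hr₁ (by linarith) (by linarith [hwidth c.1 c.2])
    (by linarith [hinf_ge c.1 c.2, hsup_le c.1 c.2]) with hP₁
  set P₂ : ι → JordanDomain := fun c => polarRect (r₁ := 2 - 2 * δ') (r₂ := 2 + 2 * δ') (θ₁ := sInf c.1 + δ' / 2)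
    (θ₂ := sSup c.1 - δ' / 2) hr₁' (by linarith) (by linarith [hwidth c.1 c.2])
    (by linarith [hinf_ge c.1 c.2, hsup_le c.1 c.2]) with hP₂
  refine ⟨ι, inferInstance, P₁, P₂, fun c => ?_, fun c => ?_, fun c c' hcc' => ?_, fun z hz => ?_⟩
  · -- `closure (P₁ c) ⊆ P₂ c`
    intro z hz
    rw [hP₁, mem_closure_polarRect_carrier_iff] at hz
    obtain ⟨r, hr, θ, hθ, rfl⟩ := hz
    rw [hP₂, mem_polarRect_carrier_iff]
    exact ⟨r, ⟨by linarith [hr.1], by linarith [hr.2]⟩, θ, ⟨by linarith [hθ.1], by linarith [hθ.2]⟩, rfl⟩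
  · -- `closure (P₂ c) ⊆ W ∩ A₀`: every point is `δ`-close to a point of `C`
    intro z hz
    rw [hP₂, mem_closure_polarRect_carrier_iff] at hz
    obtain ⟨r, hr, θ, hθ, rfl⟩ := hz
    have hθc : θ ∈ c.1 := by
      rw [hcIoo c.1 c.2]; exact ⟨by linarith [hθ.1], by linarith [hθ.2]⟩
    obtain ⟨a, ha, hd⟩ := mem_thickening_iff.1 (hcV₀ c.1 c.2 hθc)
    refine hnear (pol a) (hpolA a ha) _ ?_
    rw [dist_eq_norm, hpol]
    have h1 := norm_polar_turn_sub_le (r := r) (r' := 2) (θ := θ) (θ' := a) (by norm_num)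
    have h2 : |r - 2| ≤ 2 * δ' := by rw [abs_le]; constructor <;> linarith [hr.1, hr.2]
    rw [Real.dist_eq] at hd
    have h3 : ‖(r : ℂ) * turn θ - (2 : ℂ) * turn a‖ ≤ 2 * δ' + 2 * π * 2 * (2 * δ') := by
      have := h1; push_cast at this
      nlinarith [abs_nonneg (θ - a), pi_pos, hd.le]
    have h4 : 2 * δ' + 2 * π * 2 * (2 * δ') ≤ δ := by rw [hδ']; nlinarith [pi_le_four]
    exact (show ‖(r : ℂ) * Complex.exp (2 * π * θ * Complex.I) - 2 * turn a‖ ≤ δ from h3.trans h4)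
  · -- disjointness of the closures of `P₂ c`, `P₂ c'` for `c ≠ c'`
    rw [Set.disjoint_left]
    intro z hz hz'
    rw [hP₂, mem_closure_polarRect_carrier_iff] at hz hz'
    obtain ⟨r, hr, θ, hθ, rfl⟩ := hz
    obtain ⟨r', hr', θ', hθ', heq⟩ := hz'
    have hθc : θ ∈ c.1 := by rw [hcIoo c.1 c.2]; exact ⟨by linarith [hθ.1], by linarith [hθ.2]⟩
    have hθc' : θ' ∈ c'.1 := by rw [hcIoo c'.1 c'.2]; exact ⟨by linarith [hθ'.1], by linarith [hθ'.2]⟩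
    have hwin : |θ - θ'| < 1 := by
      have k1 := hV₀sub (hcV₀ c.1 c.2 hθc)
      have k2 := hV₀sub (hcV₀ c'.1 c'.2 hθc')
      rw [abs_lt]; constructor <;> linarith [k1.1, k1.2, k2.1, k2.2]
    have hrp : 0 < r := by linarith [hr.1]
    have hrp' : 0 < r' := by linarith [hr'.1]
    obtain ⟨-, hθθ⟩ := (polar_eq_polar_iff hrp hrp' hwin).1 heq
    subst hθθ
    -- `θ` lies in both components, so they coincide
    apply hcc'
    apply Subtype.ext
    obtain ⟨a, -, hca⟩ := c.2
    obtain ⟨a', -, hca'⟩ := c'.2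
    rw [← hca] at hθc ⊢; rw [← hca'] at hθc' ⊢
    exact (connectedComponentIn_eq hθc).trans (connectedComponentIn_eq hθc').symm
  · -- `C` is covered by the `P₁ c`
    obtain ⟨θ, hθw, hzθ⟩ := exists_eq_polar_of_norm_eq two_pos (mem_sphere_zero_iff_norm.1 (hC2 hz)) θs
    have hθA : θ ∈ A := by
      refine ⟨⟨hθw.1, hθw.2.le⟩, ?_⟩
      show pol θ ∈ C
      have e2 : pol θ = ((2 : ℝ) : ℂ) * turn θ := by rw [hpol]; push_cast; rfl
      rw [e2, ← hzθ]; exact hz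
    have hcθ : comp θ ∈ 𝒞 := ⟨θ, hθA, rfl⟩
    have hθc : θ ∈ comp θ := mem_connectedComponentIn (hAV₀ hθA)
    obtain ⟨h1, h2⟩ := hinside _ hcθ θ hθA hθc
    refine mem_iUnion.2 ⟨⟨comp θ, hcθ⟩, ?_⟩
    rw [hP₁, mem_polarRect_carrier_iff]
    refine ⟨2, ⟨by linarith, by linarith⟩, θ, ⟨by linarith, by linarith⟩, ?_⟩
    rw [hzθ]; rfl

end Literature.Topology.FourManifolds

end


noncomputable section

namespace Literature.Topology.FourManifolds

open _root_.Set _root_.Metric _root_.OpenPartialHomeomorph _root_.Filter _root_.Real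
open scoped _root_.Manifold _root_.Topology _root_.ContDiff
open Literature.Geometry.Manifold (AtlasOn)
open Literature.Geometry.Manifold.AtlasOn
open Literature.Probability.RandomPlanarGeometry (JordanDomain)
open Literature.Probability.RandomPlanarGeometry.JordanDomain
open Literature.Topology.PlaneTopology

/-- Local notation for the model plane `ℝ²`. -/
local notation "𝔼₂" => EuclideanSpace ℝ (Fin 2)

/-! ### The seam lemma, inessential case -/

/-- **Straightening a smooth structure near the seam circle and gluing in the standard disc —
the case where the seam circle is not entirely inside the structure's domain.** Let `𝒮` be a
smooth atlas on the open set `W ⊆ ℂ`, `L ⊆ W` with `L ∩ {‖z‖ = 2}` closed, and suppose the seam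
circle `{‖z‖ = 2}` is not contained in `W`. Then there is a smooth atlas `𝒮'` on an open set `W'`
with `W' ⊆ W ∪ {‖z‖ < 2}`, containing `W ∖ {‖z‖ ≤ 3}`, the disc `{‖z‖ < 2}` and `L`, and agreeing
with `𝒮` off `{‖z‖ ≤ 3}`: straighten `𝒮` over finitely many disjoint polar rectangles covering
`L ∩ {‖z‖ = 2}` (`exists_polarRects_cover`, `exists_homeomorph_pullback_agreeOn_stdAtlas_finset`),
then glue the standard structure on `{‖z‖ < 2} ∪ ⋃ P₁ i` with the straightened `𝒮` on
`{‖z‖ > 2} ∪ ⋃ P₁ i` (Radó / Kerékjártó inductive step; E. E. Moise, *Geometric topology in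
dimensions 2 and 3*, Ch. 8; A. Hatcher, arXiv:1312.3518, proof of Thm. A). [folklore] -/
theorem exists_planeAtlas_seam_of_not_subset {W : Set ℂ} (𝒮 : PlaneAtlas W) {L : Set ℂ} (hLW : L ⊆ W)
    (hC : IsClosed (L ∩ sphere (0 : ℂ) 2)) (hA : ¬ sphere (0 : ℂ) 2 ⊆ W) :
    ∃ (W' : Set ℂ) (𝒮' : PlaneAtlas W'), W' ⊆ W ∪ ball 0 2 ∧ W \ closedBall 0 3 ⊆ W' ∧ ball 0 2 ⊆ W' ∧ L ⊆ W' ∧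
      𝒮'.AgreeOn 𝒮 (closedBall 0 3)ᶜ := by
  classical
  have hW : IsOpen W := 𝒮.isOpen
  -- fat disjoint polar rectangles covering `C = L ∩ {‖z‖ = 2}`
  have hCc : IsCompact (L ∩ sphere (0 : ℂ) 2) := (isCompact_sphere 0 2).of_isClosed_subset hC inter_subset_right
  obtain ⟨ι, _, P₁, P₂, h12, h2W, hdisj, hcov⟩ := exists_polarRects_cover hW hCc
    (inter_subset_left.trans hLW) inter_subset_right hA
  -- straighten `𝒮` over the `P₁ i`
  obtain ⟨Φ, -, -, hΦW, hΦstd, hΦfar⟩ := exists_homeomorph_pullback_agreeOn_stdAtlas_finset 𝒮 Finset.univ P₁ P₂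
    (fun i _ => h12 i) (fun i _ => (h2W i).trans inter_subset_left) (fun i _ j _ hij => hdisj i j hij)
  set 𝒮₁ : PlaneAtlas W := (𝒮.pullback Φ.toOpenPartialHomeomorph).copy ((pullback_homeomorph_carrier Φ).trans hΦW)
    with h𝒮₁
  have h𝒮₁c : 𝒮₁.charts = (𝒮.pullback Φ.toOpenPartialHomeomorph).charts := rfl
  -- the neighbourhood `N` of `C` over which `𝒮₁` is standard
  set N : Set ℂ := ⋃ i, (P₁ i).carrier with hN
  have hNo : IsOpen N := isOpen_iUnion fun i => (P₁ i).isOpen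
  have hNW : N ⊆ W := iUnion_subset fun i => (subset_closure.trans (h12 i)).trans (subset_closure.trans
    ((h2W i).trans inter_subset_left))
  have hN3 : N ⊆ ball 0 3 := iUnion_subset fun i z hz => by
    have := (h2W i) (subset_closure ((h12 i) (subset_closure hz)))
    exact mem_ball_zero_iff.2 this.2.2
  have hstdN : 𝒮₁.AgreeOn (stdAtlas N hNo) N := by
    rw [agreeOn_iff_of_charts_eq h𝒮₁c rfl]
    exact agreeOn_stdAtlas_iUnion _ (fun i => (P₁ i).isOpen) fun i => hΦstd i (Finset.mem_univ i)
  -- the two pieces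
  set U : Set ℂ := ball 0 2 ∪ N with hU
  have hUo : IsOpen U := isOpen_ball.union hNo
  set 𝒜 : PlaneAtlas U := stdAtlas U hUo with h𝒜
  set V' : Set ℂ := (closedBall (0 : ℂ) 2)ᶜ ∪ N with hV'
  have hV'o : IsOpen V' := isClosed_closedBall.isOpen_compl.union hNo
  set ℬ : PlaneAtlas (W ∩ V') := 𝒮₁.restrict V' hV'o with hℬ
  -- they agree over `N`
  have hagree : 𝒜.AgreeOn ℬ N := by
    have h2 : ℬ.AgreeOn 𝒮₁ N := restrict_agreeOn 𝒮₁ hV'o hNo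
    have h3 : ℬ.AgreeOn (stdAtlas N hNo) (N ∩ W) := h2.trans hstdN hNo
    have h3' : ℬ.AgreeOn (stdAtlas N hNo) N := by
      refine agreeOn_of_agreeOn_inter h3 (fun e he => inter_subset_left.trans ((ℬ.source_subset e he).trans
        inter_subset_left)) fun e he => ?_
      rw [stdAtlas_charts, mem_singleton_iff] at he
      subst he
      rw [restr_source' _ _ hNo, stdChart_source, univ_inter]
      exact inter_subset_left.trans hNW
    have h4 : (stdAtlas N hNo).AgreeOn (stdAtlas U hUo) N := (stdAtlas_agreeOn_stdAtlas hUo hNo).symm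
    have h5 := h3'.trans h4 hNo
    exact (h5.mono (hNo.inter hNo) hNo fun x hx => ⟨hx, hx⟩).symm
  have hUV : U ∩ (W ∩ V') ⊆ N := by
    rintro x ⟨hxU, -, hxV⟩
    rcases hxV with hx | hx
    · rcases hxU with hx' | hx'
      · exact absurd (ball_subset_closedBall hx') hx
      · exact hx'
    · exact hx
  set 𝒮' := 𝒜.union ℬ hagree hNo hUV with h𝒮'
  refine ⟨U ∪ (W ∩ V'), 𝒮', ?_, ?_, subset_union_left.trans subset_union_left, fun z hz => ?_, ?_⟩
  · -- `W' ⊆ W ∪ ball 0 2`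
    rintro z (hz | hz)
    · rcases hz with hz | hz
      · exact Or.inr hz
      · exact Or.inl (hNW hz)
    · exact Or.inl hz.1
  · -- `W ∖ closedBall 0 3 ⊆ W'`
    rintro z ⟨hzW, hz3⟩
    refine Or.inr ⟨hzW, Or.inl fun hz2 => hz3 ?_⟩
    exact closedBall_subset_closedBall (by norm_num) hz2
  · -- `L ⊆ W'`
    rcases lt_trichotomy ‖z‖ 2 with h | h | h
    · exact Or.inl (Or.inl (mem_ball_zero_iff.2 h))
    · exact Or.inl (Or.inr (hcov ⟨hz, mem_sphere_zero_iff_norm.2 h⟩))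
    · exact Or.inr ⟨hLW hz, Or.inl fun h' => by have := mem_closedBall_zero_iff.1 h'; linarith⟩
  · -- agreement with `𝒮` off `closedBall 0 3`
    set O : Set ℂ := (closedBall (0 : ℂ) 3)ᶜ with hO
    have hOo : IsOpen O := isClosed_closedBall.isOpen_compl
    refine (agreeOn_union_iff.2 ⟨?_, ?_⟩).symm
    · -- the standard piece lives inside `ball 0 3`: vacuous
      refine (agreeOn_of_source_inter_eq_empty fun e he => ?_).symm
      rw [h𝒜, stdAtlas_charts, mem_singleton_iff] at he
      subst he
      rw [restr_source' _ _ hUo, stdChart_source, univ_inter, hU, hO]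
      ext z
      simp only [mem_inter_iff, mem_union, mem_compl_iff, mem_empty_iff_false, iff_false, not_and, not_not]
      rintro (hz | hz)
      · exact ball_subset_closedBall (ball_subset_ball (by norm_num) hz)
      · exact ball_subset_closedBall (hN3 hz)
    · -- the straightened piece agrees with `𝒮` off the rectangles
      have h2 : ℬ.AgreeOn 𝒮₁ O := restrict_agreeOn 𝒮₁ hV'o hOo
      have hfar' : 𝒮₁.AgreeOn 𝒮 O := by
        rw [agreeOn_iff_of_charts_eq h𝒮₁c rfl]
        refine hΦfar.mono ?_ hOo fun z hz hz' => ?_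
        · rw [isOpen_compl_iff]
          exact (Finset.finite_toSet _).isClosed_biUnion fun i _ => isClosed_closure
        · obtain ⟨i, -, hzi⟩ := mem_iUnion₂.1 hz'
          have := (h2W i hzi).2.2
          exact hz (mem_closedBall_zero_iff.2 (by linarith))
      have h3 := h2.trans hfar' hOo
      refine (agreeOn_of_agreeOn_inter h3 (fun e he => ?_) fun e he => ?_).symm
      · exact inter_subset_left.trans ((ℬ.source_subset e he).trans inter_subset_left)
      · exact inter_subset_left.trans (𝒮.source_subset e he)

end Literature.Topology.FourManifolds

end
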